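import Mathlib
import Literature.NumberTheory.LFunctions.Zhang2022.Section16BNormaliserRBounds
import Literature.NumberTheory.LFunctions.Zhang2022.GaussKernelContour
import Literature.NumberTheory.LFunctions.Zhang2022.Section15CU055Residue
import Literature.NumberTheory.LFunctions.Zhang2022.Section7ZetaNearOne
import Literature.NumberTheory.LFunctions.LFDSingleDetect
import Literature.NumberTheory.LFunctions.CharacterHarmonicTails
import Literature.NumberTheory.LFunctions.Zhang2022.Section16U041LData
import Literature.NumberTheory.LFunctions.Zhang2022.TypedSection16BLemma162Rp
import HarnessLib

/-!
# Zhang (2022) §16 p. 94 (u041): the contour shift for the smoothed sum of `ϖ₂ⱼ(ν∗χ)` — the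
# engine instance, generic in the continuation `U` of Lemma 16.2

Topic `Literature/NumberTheory/LFunctions/Zhang2022` (Landau–Siegel audit tree; verdict-neutral).
Y. Zhang, *Discrete mean estimates and the Landau–Siegel zero*, arXiv:2211.02515v1 (2022)
[Zhang2022LandauSiegel] — **an unrefereed manuscript under adjudication** (ZHANG-L discharge lane,
WP16 Block C, sub-leaf `Typed.Section16B.Step16_u041aR`; helper file of zl-libC-p5 for the owner
zl-libC-p1). §16 p. 94, tex L4665–L4667:

> By Lemma 16.2, we can move the contour of integration in the same way as in the proof of Lemma 8.4
> to obtain `Σ_{n<T} ϖ₂ⱼ(n)(ν∗χ)(n)/n = L′(1,χ)³𝔲₂ⱼ(1) + O(𝓛⁻¹⁰)`.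

For the repaired integrand `integrand16_u040R` (normaliser `ζ(1+s)²ζ(1+s−β_j)L(1+s,χ)L(1+s−β_j,χ)²`
times a continuation `U` of `E₂ⱼ`, kernel `Tˢω₁(s)/s`), this theorem-only file performs the shift
of the line `Re s = 1` to Landau's broken line `Re s = −1/20` (`|Im s| ≤ H = 𝓛¹⁶`) with the tree's
engine `GaussKernelContour.norm_lineIntegral_sub_residues_le_iteratedDeriv`, GENERICALLY in `U`
(holomorphic on `Re w > 9/10`, `|U| ≤ B` on `Re w ≥ 19/20` — the clauses of `Lemma162Rp`): the poles
crossed are the TRIPLE pole at `s = 0` (`ζ(1+s)²/s`; numerator in the `U055.pole_datum_triple` format,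
`ζ(1+z) = ζ₁(1+z)/z`) and the SIMPLE pole at `s = β_j` (`ζ(1+s−β_j)`), and the remainder is bounded by
the engine's three terms with `M₀ = 216B` (right line: `|ζ| ≤ 2`, `|L| ≤ 3` on `Re = 2`) and
`M₁ = M₂ = (20 + (5+H)³)³(5+H)³Z³D³·B` (left line and horizontals, `Section16BNormaliserRBounds`).

* `u041_contour_shift_raw` — the shift with the engine's explicit remainder;
* `u041_contour_shift` — the same remainder simplified to `C·B·e^{−𝓛}` for `D ≥ D₀`.

With `U := frakU2R c′ χ j` the integral is `∫ integrand16_u040R c′ χ j (1+it) dt` (up to `ring`), and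
(iv) of `Lemma162Rp` gives `B = C·e^{2𝓛^{1/10}}`; the residue at `0` is then evaluated by the owner's
LData (`½φ₀″(0) ≈ L′(1,χ)³U(1)`, cf. `U055.norm_residue_triple_sub_le`) and the residue at `β_j` is
small by the near-one clause (v). No new definitions, no named facts, no `sorry`; nothing here bears on
Theorems 1–2 of the source or on Landau–Siegel zeros.

## References

* Y. Zhang, arXiv:2211.02515v1 (2022), §16 p. 94 (u041); §8 Lemma 8.4 pp. 44–46; §4 (4.1)–(4.3).
  [cite: Zhang2022LandauSiegel, §16 p.94 (u041)]
* J. B. Conway, *Functions of One Complex Variable I*, GTM 11, Ch. V Thm 2.2 (residue theorem).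
  [cite: Conway1978, Ch. V Thm 2.2]
-/

noncomputable section

open Complex Real Set MeasureTheory Filter Topology
open Literature.NumberTheory.LFunctions.Zhang2022
open Literature.NumberTheory.LFunctions.Zhang2022.Skeleton
open Literature.NumberTheory.LFunctions.Zhang2022.GaussWeight

namespace Literature.NumberTheory.LFunctions.Zhang2022.Typed.Section16B

/-! ## §1. Pointwise bounds for `Φ(s) = normaliserR(1+s)·U(1+s)` -/

section Pointwise

variable (c' : ℝ) {D : ℕ} [NeZero D] {χ : DirichletCharacter ℂ D}

/-- On the right line `Re s = 1`: `|Φ(1+it)| ≤ 216·B` (`|ζ| ≤ 2`, `|L| ≤ 3` on `Re w = 2`, `|U| ≤ B`).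
[cite: Zhang2022LandauSiegel, §16 p.94 (u041)] -/
theorem norm_Phi_right_line (j : ℕ) {U : ℂ → ℂ} {B : ℝ}
    (hUB : ∀ w : ℂ, 19 / 20 ≤ w.re → ‖U w‖ ≤ B) (t : ℝ) :
    ‖normaliserR c' χ j (1 + ((1 : ℂ) + t * I)) * U (1 + ((1 : ℂ) + t * I))‖ ≤ 216 * B := by
  have hβre : (betaJ c' D j).re = 0 := betaJ_re_eq_zero c' D j
  have hre : (1 + ((1 : ℂ) + t * I)).re = 2 := by simp; norm_num
  have hre' : (1 + ((1 : ℂ) + t * I) - betaJ c' D j).re = 2 := by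
    rw [Complex.sub_re, hre, hβre]; norm_num
  have hB : 0 ≤ B := (norm_nonneg _).trans (hUB 1 (by norm_num))
  have hζ1 : ‖riemannZeta (1 + ((1 : ℂ) + t * I))‖ ≤ 2 := by
    refine (ZetaNearOne.norm_riemannZeta_le_of_re (δ := 1) one_pos (by rw [hre]; norm_num)).trans ?_
    norm_num
  have hζ2 : ‖riemannZeta (1 + ((1 : ℂ) + t * I) - betaJ c' D j)‖ ≤ 2 := by
    refine (ZetaNearOne.norm_riemannZeta_le_of_re (δ := 1) one_pos (by rw [hre']; norm_num)).trans ?_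
    norm_num
  have hL1 : ‖χ.LFunction (1 + ((1 : ℂ) + t * I))‖ ≤ 3 :=
    LFDSingle.norm_LFunction_le_three χ (by rw [hre]; norm_num)
  have hL2 : ‖χ.LFunction (1 + ((1 : ℂ) + t * I) - betaJ c' D j)‖ ≤ 3 :=
    LFDSingle.norm_LFunction_le_three χ (by rw [hre']; norm_num)
  have hU : ‖U (1 + ((1 : ℂ) + t * I))‖ ≤ B := hUB _ (by rw [hre]; norm_num)
  unfold normaliserR
  rw [norm_mul, norm_mul, norm_mul, norm_mul, norm_pow, norm_pow]
  calc ‖riemannZeta (1 + (1 + t * I))‖ ^ 2 * ‖riemannZeta (1 + (1 + t * I) - betaJ c' D j)‖ *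
        ‖χ.LFunction (1 + (1 + t * I))‖ * ‖χ.LFunction (1 + (1 + t * I) - betaJ c' D j)‖ ^ 2 *
        ‖U (1 + (1 + t * I))‖
      ≤ 2 ^ 2 * 2 * 3 * 3 ^ 2 * B := by
        refine mul_le_mul (mul_le_mul (mul_le_mul (mul_le_mul (pow_le_pow_left₀ (norm_nonneg _) hζ1 2)
          hζ2 (norm_nonneg _) (by positivity)) hL1 (norm_nonneg _) (by positivity))
          (pow_le_pow_left₀ (norm_nonneg _) hL2 2) (by positivity) (by positivity)) hU (norm_nonneg _)
          (by positivity)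
    _ = 216 * B := by ring

/-- In the closed strip `−1/20 ≤ Re s ≤ 1` at distance `≥ 1/20` from `0` and `β_j` and with
`|s| ≤ H + 1`: `|Φ(s)| ≤ (20 + (5+H)³)³(5+H)³Z³D³·B` (`Section16BNormaliserRBounds`, `|U| ≤ B` on
`Re w ≥ 19/20`). [cite: Zhang2022LandauSiegel, §16 p.94 (u041)] -/
theorem norm_Phi_le_of_region (hχ : χ ≠ 1) (j : ℕ) (hβ : ‖betaJ c' D j‖ ≤ 1) {U : ℂ → ℂ} {B : ℝ}
    (hUB : ∀ w : ℂ, 19 / 20 ≤ w.re → ‖U w‖ ≤ B) {H : ℝ} {s : ℂ} (hs : -1 / 20 ≤ s.re)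
    (hsH : ‖s‖ ≤ H + 1) (hr : 1 / 20 ≤ ‖s‖) (hrβ : 1 / 20 ≤ ‖s - betaJ c' D j‖) :
    ‖normaliserR c' χ j (1 + s) * U (1 + s)‖ ≤
      (20 + (5 + H) ^ 3) ^ 3 * (5 + H) ^ 3 * (∑' n : ℕ, ((n + 1 : ℕ) : ℝ) ^ (-(5 / 4 : ℝ))) ^ 3 *
        (D : ℝ) ^ 3 * B := by
  have hB : 0 ≤ B := (norm_nonneg _).trans (hUB 1 (by norm_num))
  have h1 := norm_normaliserR_one_add_le_of_le c' hχ j hβ (r₀ := 1 / 20) (R := H + 1) (by norm_num)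
    (by linarith) hsH hr hrβ
  have hU : ‖U (1 + s)‖ ≤ B := hUB _ (by rw [Complex.add_re, Complex.one_re]; linarith)
  rw [norm_mul]
  calc ‖normaliserR c' χ j (1 + s)‖ * ‖U (1 + s)‖
      ≤ ((1 / (1 / 20) + (4 + (H + 1)) ^ 3) ^ 3 * (4 + (H + 1)) ^ 3 *
          (∑' n : ℕ, ((n + 1 : ℕ) : ℝ) ^ (-(5 / 4 : ℝ))) ^ 3 * (D : ℝ) ^ 3) * B :=
        mul_le_mul h1 hU (norm_nonneg _) ((norm_nonneg _).trans h1)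
    _ = _ := by ring

end Pointwise

/-! ## §2. Holomorphy and the two pole data -/

section Poles

variable (c' : ℝ) {D : ℕ} [NeZero D] {χ : DirichletCharacter ℂ D}

/-- `z ↦ Y^z` is entire for `Y > 0`. [folklore] -/
private theorem differentiable_const_cpow' {Y : ℝ} (hY : 0 < Y) :
    Differentiable ℂ (fun z : ℂ => (Y : ℂ) ^ z) :=
  fun _ => differentiableAt_id.const_cpow (Or.inl (ofReal_ne_zero.mpr hY.ne'))

/-- `U ∘ (1 + ·)` is differentiable at `z` when `Re z > −1/10` and `U` is holomorphic on `Re w > 9/10`.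
[folklore] -/
private theorem differentiableAt_U_one_add {U : ℂ → ℂ} (hU : DifferentiableOn ℂ U {w : ℂ | 9 / 10 < w.re})
    {z : ℂ} (hz : -1 / 10 < z.re) : DifferentiableAt ℂ (fun z : ℂ => U (1 + z)) z := by
  have hopen : IsOpen {w : ℂ | 9 / 10 < w.re} := isOpen_lt continuous_const Complex.continuous_re
  have hmem : (1 : ℂ) + z ∈ {w : ℂ | 9 / 10 < w.re} := by
    simp only [Set.mem_setOf_eq, Complex.add_re, Complex.one_re]; linarith
  exact (hU.differentiableAt (hopen.mem_nhds hmem)).comp z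
    ((differentiableAt_const _).add differentiableAt_id)

/-- **Holomorphy of `Φ(s) = normaliserR(1+s)U(1+s)` on `{Re s > −1/10} ∖ {0, β_j}`.**
[cite: Zhang2022LandauSiegel, §16 p.94 (u041)] -/
theorem differentiableOn_Phi (hχ : χ ≠ 1) (j : ℕ) {U : ℂ → ℂ}
    (hU : DifferentiableOn ℂ U {w : ℂ | 9 / 10 < w.re}) :
    DifferentiableOn ℂ (fun z : ℂ => normaliserR c' χ j (1 + z) * U (1 + z))
      ({z : ℂ | -1 / 10 < z.re} \ (({0, betaJ c' D j} : Finset ℂ) : Set ℂ)) := by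
  intro z hz
  have hz1 : -1 / 10 < z.re := hz.1
  have hz2 : z ∉ (({0, betaJ c' D j} : Finset ℂ) : Set ℂ) := hz.2
  rw [Finset.coe_insert, Finset.coe_singleton, Set.mem_insert_iff, Set.mem_singleton_iff,
    not_or] at hz2
  exact ((differentiableAt_normaliserR_one_add c' hχ j hz2.1 hz2.2).mul
    (differentiableAt_U_one_add hU hz1)).differentiableWithinAt

/-- **Pole datum at `s = 0` (triple pole)**: on a neighbourhood of `0`, `Φ(z)·T^zω₁(z)/z =
φ₀(z)/(z−0)³` with `φ₀(z) = ζ₁(1+z)²·(ζ(1+z−β_j)L(1+z,χ)L(1+z−β_j,χ)²U(1+z))·T^zω₁(z)` holomorphic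
there (`U055.pole_datum_triple` with `g = ζ(1+z−β_j)L L² U`; needs `β_j ≠ 0`).
[cite: Conway1978, Ch. V Thm 2.2] -/
theorem pole_datum_zero (hχ : χ ≠ 1) (j : ℕ) (hβ0 : betaJ c' D j ≠ 0) (hβ : ‖betaJ c' D j‖ ≤ 1 / 40)
    {U : ℂ → ℂ} (hU : DifferentiableOn ℂ U {w : ℂ | 9 / 10 < w.re}) (Λ : ℝ) {Y : ℝ} (hY : 0 < Y) :
    ∃ V ∈ 𝓝 (0 : ℂ), DifferentiableOn ℂ (fun z : ℂ => riemannZeta₁ (1 + z) ^ 2 *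
        (riemannZeta (1 + z - betaJ c' D j) * χ.LFunction (1 + z) *
          χ.LFunction (1 + z - betaJ c' D j) ^ 2 * U (1 + z)) * ((Y : ℂ) ^ z * omega1 Λ z)) V ∧
      ∀ z ∈ V, z ≠ 0 → normaliserR c' χ j (1 + z) * U (1 + z) *
          ((Y : ℂ) ^ (z + 0) * omega1 Λ (z + 0) / (z + 0)) =
        (riemannZeta₁ (1 + z) ^ 2 * (riemannZeta (1 + z - betaJ c' D j) * χ.LFunction (1 + z) *
          χ.LFunction (1 + z - betaJ c' D j) ^ 2 * U (1 + z)) * ((Y : ℂ) ^ z * omega1 Λ z)) /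
          (z - 0) ^ (2 + 1) := by
  set β : ℂ := betaJ c' D j with hβdef
  have hr : 0 < ‖β‖ / 2 := by positivity
  -- `g` is holomorphic on the ball `|z| < |β|/2`
  have hL := DirichletCharacter.differentiable_LFunction hχ
  have hg : DifferentiableOn ℂ (fun z : ℂ => riemannZeta (1 + z - β) * χ.LFunction (1 + z) *
      χ.LFunction (1 + z - β) ^ 2 * U (1 + z)) (Metric.ball 0 (‖β‖ / 2)) := by
    intro z hz
    have hz' : ‖z‖ < ‖β‖ / 2 := by simpa using hz
    have hzβ : z ≠ β := by
      intro h; rw [h] at hz'; linarith [norm_nonneg β]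
    have h1 : (1 : ℂ) + z - β ≠ 1 := fun h => hzβ (by linear_combination h)
    have hzre : -1 / 10 < z.re := by
      have := Complex.abs_re_le_norm z
      have : |z.re| < 1 / 80 := lt_of_le_of_lt this (by linarith)
      rw [abs_lt] at this; linarith
    have hlin : DifferentiableAt ℂ (fun z : ℂ => (1 : ℂ) + z - β) z :=
      ((differentiableAt_const _).add differentiableAt_id).sub_const _
    have hζ : DifferentiableAt ℂ (fun z : ℂ => riemannZeta (1 + z - β)) z :=
      (differentiableAt_riemannZeta h1).comp z hlin
    have hLa : DifferentiableAt ℂ (fun z : ℂ => χ.LFunction (1 + z)) z :=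
      (hL _).comp z ((differentiableAt_const _).add differentiableAt_id)
    have hLb : DifferentiableAt ℂ (fun z : ℂ => χ.LFunction (1 + z - β)) z := (hL _).comp z hlin
    exact (((hζ.mul hLa).mul (hLb.pow 2)).mul (differentiableAt_U_one_add hU hzre)).differentiableWithinAt
  obtain ⟨V, hV, hdiff, hid⟩ := U055.pole_datum_triple (Metric.ball_mem_nhds 0 hr) hg Λ hY
  refine ⟨V, hV, hdiff, fun z hz hz0 => ?_⟩
  rw [add_zero, ← hid z hz hz0]
  unfold normaliserR
  ring

/-- **Pole datum at `s = β_j` (simple pole of `ζ(1+s−β_j)`)**: on a neighbourhood of `β_j`,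
`Φ(z)·T^zω₁(z)/z = φ_β(z)/(z−β_j)` with
`φ_β(z) = ζ(1+z)²ζ₁(1+z−β_j)L(1+z,χ)L(1+z−β_j,χ)²U(1+z)·(T^zω₁(z)/z)` holomorphic there
(`ζ(w) = ζ₁(w)/(w−1)`, Mathlib `riemannZeta_eq_inv_sub_mul`; needs `β_j ≠ 0`).
[cite: Conway1978, Ch. V Thm 2.2] -/
theorem pole_datum_beta (hχ : χ ≠ 1) (j : ℕ) (hβ0 : betaJ c' D j ≠ 0) (hβ : ‖betaJ c' D j‖ ≤ 1 / 40)
    {U : ℂ → ℂ} (hU : DifferentiableOn ℂ U {w : ℂ | 9 / 10 < w.re}) (Λ : ℝ) {Y : ℝ} (hY : 0 < Y) :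
    ∃ V ∈ 𝓝 (betaJ c' D j), DifferentiableOn ℂ (fun z : ℂ => riemannZeta (1 + z) ^ 2 *
        riemannZeta₁ (1 + z - betaJ c' D j) * χ.LFunction (1 + z) *
          χ.LFunction (1 + z - betaJ c' D j) ^ 2 * U (1 + z) * ((Y : ℂ) ^ z * omega1 Λ z / z)) V ∧
      ∀ z ∈ V, z ≠ betaJ c' D j → normaliserR c' χ j (1 + z) * U (1 + z) *
          ((Y : ℂ) ^ (z + 0) * omega1 Λ (z + 0) / (z + 0)) =
        (riemannZeta (1 + z) ^ 2 * riemannZeta₁ (1 + z - betaJ c' D j) * χ.LFunction (1 + z) *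
          χ.LFunction (1 + z - betaJ c' D j) ^ 2 * U (1 + z) * ((Y : ℂ) ^ z * omega1 Λ z / z)) /
          (z - betaJ c' D j) ^ (0 + 1) := by
  set β : ℂ := betaJ c' D j with hβdef
  have hr : 0 < ‖β‖ / 2 := by positivity
  have hL := DirichletCharacter.differentiable_LFunction hχ
  refine ⟨Metric.ball β (‖β‖ / 2), Metric.ball_mem_nhds β hr, ?_, fun z hz hzβ => ?_⟩
  · intro z hz
    have hz' : ‖z - β‖ < ‖β‖ / 2 := by simpa [dist_eq_norm] using hz
    have hz0 : z ≠ 0 := by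
      intro h; rw [h, zero_sub, norm_neg] at hz'; linarith [norm_nonneg β]
    have hzn : ‖z‖ < 3 / 80 := by
      have : ‖z‖ ≤ ‖z - β‖ + ‖β‖ := by
        calc ‖z‖ = ‖(z - β) + β‖ := by ring_nf
          _ ≤ ‖z - β‖ + ‖β‖ := norm_add_le _ _
      linarith
    have hzre : -1 / 10 < z.re := by
      have := Complex.abs_re_le_norm z
      have : |z.re| < 3 / 80 := lt_of_le_of_lt this hzn
      rw [abs_lt] at this; linarith
    have h1 : (1 : ℂ) + z ≠ 1 := fun h => hz0 (by linear_combination h)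
    have hlin0 : DifferentiableAt ℂ (fun z : ℂ => (1 : ℂ) + z) z :=
      (differentiableAt_const _).add differentiableAt_id
    have hlin : DifferentiableAt ℂ (fun z : ℂ => (1 : ℂ) + z - β) z := hlin0.sub_const _
    have hζa : DifferentiableAt ℂ (fun z : ℂ => riemannZeta (1 + z)) z :=
      (differentiableAt_riemannZeta h1).comp z hlin0
    have hζb : DifferentiableAt ℂ (fun z : ℂ => riemannZeta₁ (1 + z - β)) z :=
      (differentiable_riemannZeta₁ _).comp z hlin
    have hLa : DifferentiableAt ℂ (fun z : ℂ => χ.LFunction (1 + z)) z := (hL _).comp z hlin0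
    have hLb : DifferentiableAt ℂ (fun z : ℂ => χ.LFunction (1 + z - β)) z := (hL _).comp z hlin
    have hK : DifferentiableAt ℂ (fun z : ℂ => (Y : ℂ) ^ z * omega1 Λ z / z) z :=
      ((differentiable_const_cpow' hY z).mul (U055.differentiable_omega1 Λ z)).div
        differentiableAt_id hz0
    exact ((((((hζa.pow 2).mul hζb).mul hLa).mul (hLb.pow 2)).mul
      (differentiableAt_U_one_add hU hzre)).mul hK).differentiableWithinAt
  · have h1 : (1 : ℂ) + z - β ≠ 1 := fun h => hzβ (by linear_combination h)
    have hzb : z - β ≠ 0 := sub_ne_zero.mpr hzβ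
    rw [add_zero, zero_add, pow_one]
    unfold normaliserR
    rw [riemannZeta_eq_inv_sub_mul h1, show (1 : ℂ) + z - β - 1 = z - β by ring]
    field_simp
    ring

end Poles

/-! ## §3. The contour shift with the engine's explicit remainder -/

section Raw

variable (c' : ℝ) {D : ℕ} [NeZero D] {χ : DirichletCharacter ℂ D}

/-- **The u041 contour shift, raw form.** For `χ ≠ χ₀`, `𝓛 ≥ 2`, `β_j ≠ 0` with `|β_j| ≤ 1/40`, and any
`U` holomorphic on `Re w > 9/10` with `|U| ≤ B` on `Re w ≥ 19/20`:
`‖(1/2π)∫_ℝ Φ(1+it)T^{1+it}ω₁(1+it)/(1+it) dt − (Res₀ + φ_β(β_j))‖ ≤` the three remainder terms of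
(`Res₀ = (swap dslope 0)^[2] φ₀ 0 = ½φ₀″(0)`, `U055.residue_triple_eq`)
`GaussKernelContour.norm_lineIntegral_sub_residues_le` at `σ₀ = 1`, `a = −1/20`, `H = 𝓛¹⁶`,
`Λ = 𝓛³⁰`, `Y = T`, `M₀ = 216B`, `M₁ = M₂ = (20 + (5+H)³)³(5+H)³Z³D³B`.
[cite: Zhang2022LandauSiegel, §16 p.94 (u041)] -/
theorem u041_contour_shift_raw (hχ : χ ≠ 1) (hℓ : 2 ≤ ell D) (j : ℕ) (hβ0 : betaJ c' D j ≠ 0)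
    (hβ : ‖betaJ c' D j‖ ≤ 1 / 40) {U : ℂ → ℂ} {B : ℝ}
    (hU : DifferentiableOn ℂ U {w : ℂ | 9 / 10 < w.re}) (hUB : ∀ w : ℂ, 19 / 20 ≤ w.re → ‖U w‖ ≤ B) :
    ‖(1 / (2 * π) : ℂ) * (∫ t : ℝ, normaliserR c' χ j (1 + ((1 : ℂ) + t * I)) *
          U (1 + ((1 : ℂ) + t * I)) *
          ((bigT D : ℂ) ^ ((1 : ℂ) + t * I) * omega1 (ell D ^ 30) ((1 : ℂ) + t * I) /
            ((1 : ℂ) + t * I))) -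
        ((Function.swap dslope (0 : ℂ))^[2] (fun z : ℂ => riemannZeta₁ (1 + z) ^ 2 *
              (riemannZeta (1 + z - betaJ c' D j) * χ.LFunction (1 + z) *
                χ.LFunction (1 + z - betaJ c' D j) ^ 2 * U (1 + z)) *
              ((bigT D : ℂ) ^ z * omega1 (ell D ^ 30) z)) 0 +
          (fun z : ℂ => riemannZeta (1 + z) ^ 2 * riemannZeta₁ (1 + z - betaJ c' D j) *
              χ.LFunction (1 + z) * χ.LFunction (1 + z - betaJ c' D j) ^ 2 * U (1 + z) *
              ((bigT D : ℂ) ^ z * omega1 (ell D ^ 30) z / z)) (betaJ c' D j))‖ ≤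
      1 / (2 * π) *
        (2 * (216 * B * (bigT D ^ ((1 : ℝ) + (0 : ℂ).re) * rexp (((1 : ℝ) + (0 : ℂ).re) ^ 2 /
              (4 * ell D ^ 30)) / |(1 : ℝ) + (0 : ℂ).re|) *
            (gauss (4 * ell D ^ 30)⁻¹ (ell D ^ 16 - |(0 : ℂ).im|) *
              (Real.sqrt (4 * π * ell D ^ 30) / 2))) +
          (20 + (5 + ell D ^ 16) ^ 3) ^ 3 * (5 + ell D ^ 16) ^ 3 *
              (∑' n : ℕ, ((n + 1 : ℕ) : ℝ) ^ (-(5 / 4 : ℝ))) ^ 3 * (D : ℝ) ^ 3 * B *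
            (bigT D ^ ((-1 / 20 : ℝ) + (0 : ℂ).re) * rexp (((-1 / 20 : ℝ) + (0 : ℂ).re) ^ 2 /
              (4 * ell D ^ 30)) / |(-1 / 20 : ℝ) + (0 : ℂ).re|) * Real.sqrt (4 * π * ell D ^ 30) +
          2 * (((1 : ℝ) - (-1 / 20 : ℝ)) *
            ((20 + (5 + ell D ^ 16) ^ 3) ^ 3 * (5 + ell D ^ 16) ^ 3 *
                (∑' n : ℕ, ((n + 1 : ℕ) : ℝ) ^ (-(5 / 4 : ℝ))) ^ 3 * (D : ℝ) ^ 3 * B *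
              (max (bigT D ^ ((-1 / 20 : ℝ) + (0 : ℂ).re)) (bigT D ^ ((1 : ℝ) + (0 : ℂ).re)) *
                rexp (max (((-1 / 20 : ℝ) + (0 : ℂ).re) ^ 2) (((1 : ℝ) + (0 : ℂ).re) ^ 2) /
                  (4 * ell D ^ 30)) *
                gauss (4 * ell D ^ 30)⁻¹ (ell D ^ 16 - |(0 : ℂ).im|) /
                  (ell D ^ 16 - |(0 : ℂ).im|))))) := by
  -- names
  set β : ℂ := betaJ c' D j with hβdef
  set Λ : ℝ := ell D ^ 30 with hΛdef
  set H : ℝ := ell D ^ 16 with hHdef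
  set T : ℝ := bigT D with hTdef
  set Z : ℝ := ∑' n : ℕ, ((n + 1 : ℕ) : ℝ) ^ (-(5 / 4 : ℝ)) with hZdef
  set Φ : ℂ → ℂ := fun z => normaliserR c' χ j (1 + z) * U (1 + z) with hΦdef
  set M₁ : ℝ := (20 + (5 + H) ^ 3) ^ 3 * (5 + H) ^ 3 * Z ^ 3 * (D : ℝ) ^ 3 * B with hM₁def
  have hℓ0 : 0 < ell D := by linarith
  have hΛ : 0 < Λ := by positivity
  have hY : 0 < T := Real.exp_pos _
  have hH1 : 1 ≤ H := one_le_pow₀ (by linarith)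
  have hB : 0 ≤ B := (norm_nonneg _).trans (hUB 1 (by norm_num))
  have hZ0 : 0 ≤ Z := tsum_nonneg fun n => Real.rpow_nonneg (Nat.cast_nonneg _) _
  have hβ1 : ‖β‖ ≤ 1 := hβ.trans (by norm_num)
  have hβre : β.re = 0 := betaJ_re_eq_zero c' D j
  have hβim : |β.im| ≤ 1 / 40 := (Complex.abs_im_le_norm β).trans hβ
  -- the engine's hypotheses
  have haσ : (-1 / 20 : ℝ) < 1 := by norm_num
  have hHβ : |(0 : ℂ).im| < H := by simp; linarith
  have ha : (-1 / 20 : ℝ) + (0 : ℂ).re ≠ 0 := by simp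
  have hσ₀ : (1 : ℝ) + (0 : ℂ).re ≠ 0 := by simp
  have hM₀ : 0 ≤ 216 * B := by positivity
  have hM₁ : 0 ≤ M₁ := by positivity
  -- (Φ₀) the right line
  have hΦ₀' : ∀ t : ℝ, ‖Φ (((1 : ℝ) : ℂ) + t * I)‖ ≤ 216 * B := by
    intro t
    simp only [hΦdef, Complex.ofReal_one]
    exact norm_Phi_right_line c' j hUB t
  have hΦ₀ : ∀ t : ℝ, H ≤ |t| → ‖Φ (((1 : ℝ) : ℂ) + t * I)‖ ≤ 216 * B := fun t _ => hΦ₀' t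
  -- (Φ₁) the left line
  have hΦ₁ : ∀ t : ℝ, |t| ≤ H → ‖Φ (((-1 / 20 : ℝ) : ℂ) + t * I)‖ ≤ M₁ := by
    intro t ht
    have hsre : (((-1 / 20 : ℝ) : ℂ) + t * I).re = -1 / 20 := by simp
    have hsim : (((-1 / 20 : ℝ) : ℂ) + t * I).im = t := by simp
    have hs : -1 / 20 ≤ (((-1 / 20 : ℝ) : ℂ) + t * I).re := by rw [hsre]
    have hsH : ‖((-1 / 20 : ℝ) : ℂ) + t * I‖ ≤ H + 1 := by
      refine (Complex.norm_le_abs_re_add_abs_im _).trans ?_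
      rw [hsre, hsim]; norm_num; linarith
    have hr : 1 / 20 ≤ ‖((-1 / 20 : ℝ) : ℂ) + t * I‖ := by
      refine le_trans ?_ (Complex.abs_re_le_norm _)
      rw [hsre]; norm_num
    have hrβ : 1 / 20 ≤ ‖((-1 / 20 : ℝ) : ℂ) + t * I - β‖ := by
      refine le_trans ?_ (Complex.abs_re_le_norm _)
      rw [Complex.sub_re, hsre, hβre]; norm_num
    exact norm_Phi_le_of_region c' hχ j hβ1 hUB hs hsH hr hrβ
  -- (Φ₂) the horizontals
  have hΦ₂ : ∀ u : ℝ, (-1 / 20 : ℝ) ≤ u → u ≤ 1 →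
      ‖Φ ((u : ℂ) + (H : ℂ) * I)‖ ≤ M₁ ∧ ‖Φ ((u : ℂ) + ((-H : ℝ) : ℂ) * I)‖ ≤ M₁ := by
    intro u hu1 hu2
    have key : ∀ h : ℝ, |h| = H → ‖Φ ((u : ℂ) + (h : ℂ) * I)‖ ≤ M₁ := by
      intro h hh
      have hsre : ((u : ℂ) + (h : ℂ) * I).re = u := by simp
      have hsim : ((u : ℂ) + (h : ℂ) * I).im = h := by simp
      have hs : -1 / 20 ≤ ((u : ℂ) + (h : ℂ) * I).re := by rw [hsre]; exact hu1
      have hsH : ‖(u : ℂ) + (h : ℂ) * I‖ ≤ H + 1 := by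
        refine (Complex.norm_le_abs_re_add_abs_im _).trans ?_
        rw [hsre, hsim, hh]
        have : |u| ≤ 1 := abs_le.mpr ⟨by linarith, hu2⟩
        linarith
      have hr : 1 / 20 ≤ ‖(u : ℂ) + (h : ℂ) * I‖ := by
        refine le_trans ?_ (Complex.abs_im_le_norm _)
        rw [hsim, hh]; linarith
      have hrβ : 1 / 20 ≤ ‖(u : ℂ) + (h : ℂ) * I - β‖ := by
        refine le_trans ?_ (Complex.abs_im_le_norm _)
        rw [Complex.sub_im, hsim]
        have : |h| - |β.im| ≤ |h - β.im| := abs_sub_abs_le_abs_sub h β.im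
        linarith
      exact norm_Phi_le_of_region c' hχ j hβ1 hUB hs hsH hr hrβ
    refine ⟨?_, ?_⟩
    · have := key H (abs_of_pos (by linarith))
      simpa using this
    · exact key (-H) (by rw [abs_neg, abs_of_pos (by linarith)])
  -- integrability on the right line
  have hcont : Continuous fun t : ℝ => Φ (((1 : ℝ) : ℂ) + t * I) := by
    have hline : Continuous fun t : ℝ => ((1 : ℝ) : ℂ) + t * I := by fun_prop
    have hmaps : ∀ t : ℝ, ((1 : ℝ) : ℂ) + t * I ∈
        ({z : ℂ | -1 / 10 < z.re} \ (({0, β} : Finset ℂ) : Set ℂ)) := by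
      intro t
      refine ⟨by simp; norm_num, ?_⟩
      rw [Finset.coe_insert, Finset.coe_singleton, Set.mem_insert_iff, Set.mem_singleton_iff, not_or]
      constructor
      · intro h; have := congrArg Complex.re h; simp at this
      · intro h; have := congrArg Complex.re h; rw [hβre] at this; simp at this
    exact ((differentiableOn_Phi c' hχ j hU).continuousOn).comp_continuous hline hmaps
  have hint := GaussKernelContour.integrable_integrand_line (Φ := Φ) (β := (0 : ℂ)) hΛ hY hσ₀ hcont hΦ₀'
  -- the pole set and data
  set S : Finset ℂ := {0, β} with hSdef
  set n : ℂ → ℕ := fun p => if p = 0 then 2 else 0 with hndef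
  set φ : ℂ → ℂ → ℂ := fun p => if p = 0 then
      (fun z : ℂ => riemannZeta₁ (1 + z) ^ 2 *
        (riemannZeta (1 + z - β) * χ.LFunction (1 + z) * χ.LFunction (1 + z - β) ^ 2 * U (1 + z)) *
        ((T : ℂ) ^ z * omega1 Λ z))
    else
      (fun z : ℂ => riemannZeta (1 + z) ^ 2 * riemannZeta₁ (1 + z - β) * χ.LFunction (1 + z) *
        χ.LFunction (1 + z - β) ^ 2 * U (1 + z) * ((T : ℂ) ^ z * omega1 Λ z / z)) with hφdef
  have hUo : IsOpen {z : ℂ | -1 / 10 < z.re} := isOpen_lt continuous_const Complex.continuous_re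
  have hKU : Icc (-1 / 20 : ℝ) 1 ×ℂ Icc (-H) H ⊆ {z : ℂ | -1 / 10 < z.re} := by
    intro z hz
    rw [Complex.mem_reProdIm] at hz
    simp only [Set.mem_setOf_eq]
    linarith [hz.1.1]
  have hS : (S : Set ℂ) ⊆ Ioo (-1 / 20 : ℝ) 1 ×ℂ Ioo (-H) H := by
    intro p hp
    rw [hSdef, Finset.coe_insert, Finset.coe_singleton, Set.mem_insert_iff, Set.mem_singleton_iff] at hp
    rw [Complex.mem_reProdIm]
    rcases hp with rfl | rfl
    · simp only [Complex.zero_re, Complex.zero_im, Set.mem_Ioo]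
      exact ⟨⟨by norm_num, by norm_num⟩, ⟨by linarith, by linarith⟩⟩
    · rw [hβre, Set.mem_Ioo, Set.mem_Ioo]
      have := abs_le.mp hβim
      exact ⟨⟨by norm_num, by norm_num⟩, ⟨by linarith, by linarith⟩⟩
  have h0S : -(0 : ℂ) ∈ S := by simp [hSdef]
  have hG := GaussKernelContour.differentiableOn_mul_kernel_sdiff (Φ := Φ) (β := (0 : ℂ)) hY Λ h0S
    (differentiableOn_Phi c' hχ j hU)
  have hpole : ∀ p ∈ S, ∃ V ∈ 𝓝 p, DifferentiableOn ℂ (φ p) V ∧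
      ∀ z ∈ V, z ≠ p → Φ z * ((T : ℂ) ^ (z + 0) * omega1 Λ (z + 0) / (z + 0)) =
        φ p z / (z - p) ^ (n p + 1) := by
    intro p hp
    rw [hSdef, Finset.mem_insert, Finset.mem_singleton] at hp
    rcases hp with rfl | rfl
    · simp only [hφdef, hndef, if_pos rfl]
      exact pole_datum_zero c' hχ j hβ0 hβ hU Λ hY
    · simp only [hφdef, hndef, if_neg hβ0]
      exact pole_datum_beta c' hχ j hβ0 hβ hU Λ hY
  have key := GaussKernelContour.norm_lineIntegral_sub_residues_le (Φ := Φ) (β := (0 : ℂ))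
    hΛ hY haσ hHβ ha hσ₀ hM₀ hM₁ hM₁ hΦ₀ hΦ₁ hΦ₂ hint S n φ _ hUo hKU hS hG hpole
  -- rewrite the left side into the stated form
  have hsum : ∑ p ∈ S, (Function.swap dslope p)^[n p] (φ p) p =
      (Function.swap dslope (0 : ℂ))^[2] (fun z : ℂ => riemannZeta₁ (1 + z) ^ 2 *
          (riemannZeta (1 + z - β) * χ.LFunction (1 + z) * χ.LFunction (1 + z - β) ^ 2 * U (1 + z)) *
          ((T : ℂ) ^ z * omega1 Λ z)) 0 +
        (fun z : ℂ => riemannZeta (1 + z) ^ 2 * riemannZeta₁ (1 + z - β) * χ.LFunction (1 + z) *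
          χ.LFunction (1 + z - β) ^ 2 * U (1 + z) * ((T : ℂ) ^ z * omega1 Λ z / z)) β := by
    rw [hSdef, Finset.sum_pair (Ne.symm hβ0)]
    simp only [hndef, hφdef, if_pos rfl, if_neg hβ0, Function.iterate_zero, id]
  have hint_eq : (fun t : ℝ => Φ (((1 : ℝ) : ℂ) + t * I) *
      ((T : ℂ) ^ (((1 : ℝ) : ℂ) + t * I + 0) * omega1 Λ (((1 : ℝ) : ℂ) + t * I + 0) /
        (((1 : ℝ) : ℂ) + t * I + 0))) =
      fun t : ℝ => normaliserR c' χ j (1 + ((1 : ℂ) + t * I)) * U (1 + ((1 : ℂ) + t * I)) *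
        ((T : ℂ) ^ ((1 : ℂ) + t * I) * omega1 Λ ((1 : ℂ) + t * I) / ((1 : ℂ) + t * I)) := by
    funext t
    simp only [hΦdef, add_zero, Complex.ofReal_one]
  rw [hsum, hint_eq] at key
  exact key

end Raw

/-! ## §4. Absorbing the scales: the remainder is `≤ K·B·e^{−𝓛}` -/

section Scales

/-- Exponent bookkeeping at `u = ℓ^{1/10} ≥ 100`: `ℓ = u¹⁰`, `ℓ ≥ 100⁹u`, `log ℓ ≤ 10u`,
`ℓ^{1.1} = ℓu`. [folklore] -/
private theorem scales_aux {ℓ : ℝ} (hℓ : (10 : ℝ) ^ 20 ≤ ℓ) :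
    100 ≤ ℓ ^ (1 / 10 : ℝ) ∧ (100 : ℝ) ^ 9 * ℓ ^ (1 / 10 : ℝ) ≤ ℓ ∧
      Real.log ℓ ≤ 10 * ℓ ^ (1 / 10 : ℝ) ∧ ℓ ^ (1.1 : ℝ) = ℓ * ℓ ^ (1 / 10 : ℝ) := by
  have hℓ0 : 0 < ℓ := lt_of_lt_of_le (by positivity) hℓ
  set u : ℝ := ℓ ^ (1 / 10 : ℝ) with hu
  have hu0 : 0 ≤ u := Real.rpow_nonneg hℓ0.le _
  have hu10 : u ^ 10 = ℓ := by
    rw [hu, ← Real.rpow_natCast, ← Real.rpow_mul hℓ0.le]; norm_num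
  have h100 : (100 : ℝ) ≤ u := by
    have h1 : ((10 : ℝ) ^ 20) ^ (1 / 10 : ℝ) ≤ u := Real.rpow_le_rpow (by positivity) hℓ (by norm_num)
    have h2 : ((10 : ℝ) ^ 20) ^ (1 / 10 : ℝ) = 100 := by
      rw [show (10 : ℝ) ^ 20 = (100 : ℝ) ^ (10 : ℕ) by norm_num, ← Real.rpow_natCast,
        ← Real.rpow_mul (by norm_num)]
      norm_num
    linarith
  refine ⟨h100, ?_, ?_, ?_⟩
  · calc (100 : ℝ) ^ 9 * u ≤ u ^ 9 * u :=
        mul_le_mul_of_nonneg_right (pow_le_pow_left₀ (by norm_num) h100 9) hu0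
      _ = ℓ := by rw [← hu10]; ring
  · have := Real.log_le_rpow_div hℓ0.le (show (0 : ℝ) < 1 / 10 by norm_num)
    rw [← hu] at this
    linarith [show ℓ ^ (1 / 10 : ℝ) / (1 / 10) = 10 * u by rw [hu]; ring]
  · rw [show (1.1 : ℝ) = 1 + 1 / 10 by norm_num, Real.rpow_add hℓ0, Real.rpow_one]

/-- `ℓ^k ≤ e^{10ku}` for `u = ℓ^{1/10}`, `ℓ ≥ 10²⁰`. [folklore] -/
private theorem pow_le_exp_aux {ℓ : ℝ} (hℓ : (10 : ℝ) ^ 20 ≤ ℓ) (k : ℕ) :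
    ℓ ^ k ≤ rexp (10 * k * ℓ ^ (1 / 10 : ℝ)) := by
  have hℓ0 : 0 < ℓ := lt_of_lt_of_le (by positivity) hℓ
  obtain ⟨-, -, hlog, -⟩ := scales_aux hℓ
  calc ℓ ^ k = rexp (k * Real.log ℓ) := by
        rw [← Real.rpow_natCast, Real.rpow_def_of_pos hℓ0]; ring_nf
    _ ≤ rexp (10 * k * ℓ ^ (1 / 10 : ℝ)) := Real.exp_le_exp.mpr (by nlinarith [Nat.cast_nonneg (α := ℝ) k])

/-- The three exponent comparisons (linear in the atoms `u, ℓ, ℓu, ℓ²`). [folklore] -/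
private theorem expo_ineqs {ℓ u : ℝ} (hu : 100 ≤ u) (hA : 100 * ℓ ≤ ℓ * u)
    (hQ : (100 : ℝ) ^ 9 * (ℓ * u) ≤ ℓ * ℓ) (hℓu : (100 : ℝ) ^ 9 * u ≤ ℓ) :
    ℓ * u + -(ℓ * ℓ) / 4 + 10 * ((15 : ℕ) : ℝ) * u ≤ -ℓ ∧
      10 * ((207 : ℕ) : ℝ) * u + 3 * ℓ + -(ℓ * u) / 20 ≤ -ℓ ∧
      10 * ((192 : ℕ) : ℝ) * u + 3 * ℓ + (ℓ * u + -(ℓ * ℓ) / 4) ≤ -ℓ := by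
  have hℓu0 : 0 ≤ ℓ * u := by nlinarith
  push_cast
  refine ⟨by linarith, by linarith, by linarith⟩

/-- **The engine's remainder at the u041 scales is `≤ K·B·e^{−ℓ}`** (`ℓ ≥ 10²⁰`, `T = e^{ℓ^{1.1}}`,
`Λ = ℓ³⁰`, `H = ℓ¹⁶`, `a = −1/20`, `D ≤ e^ℓ`): the right tail `≍ T·e^{−ℓ²/4}`, the left line
`≍ poly(ℓ)·D³·T^{−1/20}`, the horizontals `≍ poly(ℓ)D³·T·e^{−ℓ²/4}`. [cite: Zhang2022LandauSiegel, §16 p.94 (u041)] -/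
theorem u041_remainder_le :
    ∃ K : ℝ, 0 ≤ K ∧ ∀ (ℓ B d : ℝ), (10 : ℝ) ^ 20 ≤ ℓ → 0 ≤ B → 0 ≤ d → d ≤ rexp ℓ →
      1 / (2 * π) *
        (2 * (216 * B * (rexp (ℓ ^ (1.1 : ℝ)) ^ ((1 : ℝ) + (0 : ℂ).re) *
              rexp (((1 : ℝ) + (0 : ℂ).re) ^ 2 / (4 * ℓ ^ 30)) / |(1 : ℝ) + (0 : ℂ).re|) *
            (gauss (4 * ℓ ^ 30)⁻¹ (ℓ ^ 16 - |(0 : ℂ).im|) *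
              (Real.sqrt (4 * π * ℓ ^ 30) / 2))) +
          (20 + (5 + ℓ ^ 16) ^ 3) ^ 3 * (5 + ℓ ^ 16) ^ 3 *
              (∑' n : ℕ, ((n + 1 : ℕ) : ℝ) ^ (-(5 / 4 : ℝ))) ^ 3 * d ^ 3 * B *
            (rexp (ℓ ^ (1.1 : ℝ)) ^ ((-1 / 20 : ℝ) + (0 : ℂ).re) *
              rexp (((-1 / 20 : ℝ) + (0 : ℂ).re) ^ 2 / (4 * ℓ ^ 30)) / |(-1 / 20 : ℝ) + (0 : ℂ).re|) *
            Real.sqrt (4 * π * ℓ ^ 30) +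
          2 * (((1 : ℝ) - (-1 / 20 : ℝ)) *
            ((20 + (5 + ℓ ^ 16) ^ 3) ^ 3 * (5 + ℓ ^ 16) ^ 3 *
                (∑' n : ℕ, ((n + 1 : ℕ) : ℝ) ^ (-(5 / 4 : ℝ))) ^ 3 * d ^ 3 * B *
              (max (rexp (ℓ ^ (1.1 : ℝ)) ^ ((-1 / 20 : ℝ) + (0 : ℂ).re))
                  (rexp (ℓ ^ (1.1 : ℝ)) ^ ((1 : ℝ) + (0 : ℂ).re)) *
                rexp (max (((-1 / 20 : ℝ) + (0 : ℂ).re) ^ 2) (((1 : ℝ) + (0 : ℂ).re) ^ 2) /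
                  (4 * ℓ ^ 30)) *
                gauss (4 * ℓ ^ 30)⁻¹ (ℓ ^ 16 - |(0 : ℂ).im|) / (ℓ ^ 16 - |(0 : ℂ).im|))))) ≤
        K * B * rexp (-ℓ) := by
  set Z : ℝ := ∑' n : ℕ, ((n + 1 : ℕ) : ℝ) ^ (-(5 / 4 : ℝ)) with hZdef
  have hZ0 : 0 ≤ Z := tsum_nonneg fun n => Real.rpow_nonneg (Nat.cast_nonneg _) _
  refine ⟨1 / (2 * π) * rexp 1 * (864 + 500000 * Z ^ 3), by positivity,
    fun ℓ B d hℓ hB hd hdℓ => ?_⟩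
  have hℓ0 : 0 < ℓ := lt_of_lt_of_le (by positivity) hℓ
  have hℓ1 : 1 ≤ ℓ := le_trans (by norm_num) hℓ
  obtain ⟨hu, hℓu, hlog, h11⟩ := scales_aux hℓ
  set u : ℝ := ℓ ^ (1 / 10 : ℝ) with hudef
  set T : ℝ := rexp (ℓ ^ (1.1 : ℝ)) with hTdef
  simp only [Complex.zero_re, Complex.zero_im, add_zero, sub_zero, abs_zero, Real.rpow_one, one_pow,
    abs_one, div_one]
  -- the elementary pieces
  have hu0 : 0 ≤ u := by positivity
  have hT : T = rexp (ℓ * u) := by rw [hTdef, h11]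
  have hT1 : 1 ≤ T := by rw [hT]; exact Real.one_le_exp (by positivity)
  have hTpow : T ^ (-1 / 20 : ℝ) = rexp (-(ℓ * u) / 20) := by
    rw [hT, ← Real.exp_mul]; ring_nf
  have hTpow1 : T ^ (-1 / 20 : ℝ) ≤ 1 := by
    rw [hTpow]; exact Real.exp_le_one_iff.mpr (by nlinarith)
  have hmax : max (T ^ (-1 / 20 : ℝ)) T = T := max_eq_right (hTpow1.trans hT1)
  have habs : |(-1 / 20 : ℝ)| = 1 / 20 := by rw [abs_of_neg (by norm_num)]; norm_num
  have hmax2 : max ((-1 / 20 : ℝ) ^ 2) 1 = 1 := max_eq_right (by norm_num)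
  have hΛ1 : 1 ≤ 4 * ℓ ^ 30 := by nlinarith [one_le_pow₀ (n := 30) hℓ1]
  have hE1 : rexp (1 / (4 * ℓ ^ 30)) ≤ rexp 1 :=
    Real.exp_le_exp.mpr ((div_le_one (by positivity)).mpr hΛ1)
  have hE2 : rexp ((-1 / 20 : ℝ) ^ 2 / (4 * ℓ ^ 30)) ≤ rexp 1 := by
    refine Real.exp_le_exp.mpr ((div_le_one (by positivity)).mpr (le_trans (by norm_num) hΛ1))
  have hG : gauss (4 * ℓ ^ 30)⁻¹ (ℓ ^ 16) = rexp (-(ℓ * ℓ) / 4) := by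
    rw [gauss]; congr 1; field_simp
  have hS : Real.sqrt (4 * π * ℓ ^ 30) ≤ 4 * ℓ ^ 15 := by
    have hπ : π ≤ 4 := Real.pi_le_four
    calc Real.sqrt (4 * π * ℓ ^ 30) ≤ Real.sqrt ((4 * ℓ ^ 15) ^ 2) :=
          Real.sqrt_le_sqrt (by nlinarith [pow_nonneg hℓ0.le 30, show ℓ ^ 30 = (ℓ ^ 15) ^ 2 by ring])
      _ = 4 * ℓ ^ 15 := Real.sqrt_sq (by positivity)
  have hM : (20 + (5 + ℓ ^ 16) ^ 3) ^ 3 * (5 + ℓ ^ 16) ^ 3 ≤ 5832 * ℓ ^ 192 := by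
    have hH5 : (5 : ℝ) ≤ ℓ ^ 16 :=
      le_trans (le_trans (by norm_num) hu) (le_trans (le_trans (le_mul_of_one_le_left hu0 (by norm_num)) hℓu)
        (le_self_pow₀ hℓ1 (by norm_num)))
    have h1 : (5 + ℓ ^ 16) ^ 3 ≤ (2 * ℓ ^ 16) ^ 3 := pow_le_pow_left₀ (by positivity) (by linarith) 3
    have h2 : (20 : ℝ) ≤ (ℓ ^ 16) ^ 3 := le_trans (by norm_num) (pow_le_pow_left₀ (by norm_num) hH5 3)
    have h3 : 20 + (5 + ℓ ^ 16) ^ 3 ≤ 9 * (ℓ ^ 16) ^ 3 := by nlinarith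
    calc (20 + (5 + ℓ ^ 16) ^ 3) ^ 3 * (5 + ℓ ^ 16) ^ 3 ≤ (9 * (ℓ ^ 16) ^ 3) ^ 3 * (2 * ℓ ^ 16) ^ 3 :=
          mul_le_mul (pow_le_pow_left₀ (by positivity) h3 3) h1 (by positivity) (by positivity)
      _ = 5832 * ℓ ^ 192 := by ring
  have hd3 : d ^ 3 ≤ rexp (3 * ℓ) := by
    calc d ^ 3 ≤ (rexp ℓ) ^ 3 := pow_le_pow_left₀ hd hdℓ 3
      _ = rexp (3 * ℓ) := by rw [← Real.exp_nat_mul]; norm_num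
  have hp15 := pow_le_exp_aux hℓ 15
  have hp207 := pow_le_exp_aux hℓ 207
  have hp192 := pow_le_exp_aux hℓ 192
  rw [← hudef] at hp15 hp207 hp192
  -- exponent comparisons
  have hA : 100 * ℓ ≤ ℓ * u := by
    have := mul_le_mul_of_nonneg_left hu hℓ0.le; linarith
  have hQ : (100 : ℝ) ^ 9 * (ℓ * u) ≤ ℓ * ℓ := by
    have := mul_le_mul_of_nonneg_left hℓu hℓ0.le; linarith
  obtain ⟨hX1, hX2, hX3⟩ := expo_ineqs hu hA hQ hℓu
  -- the three terms
  have hB' : 0 ≤ B := hB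
  have h1 : 2 * (216 * B * (T * rexp (1 / (4 * ℓ ^ 30))) *
      (gauss (4 * ℓ ^ 30)⁻¹ (ℓ ^ 16) * (Real.sqrt (4 * π * ℓ ^ 30) / 2))) ≤
      864 * rexp 1 * B * rexp (-ℓ) := by
    rw [hG, hT]
    have hcore : rexp (ℓ * u) * rexp (-(ℓ * ℓ) / 4) * ℓ ^ 15 ≤ rexp (-ℓ) := by
      calc rexp (ℓ * u) * rexp (-(ℓ * ℓ) / 4) * ℓ ^ 15
          ≤ rexp (ℓ * u) * rexp (-(ℓ * ℓ) / 4) * rexp (10 * (15 : ℕ) * u) := by gcongr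
        _ = rexp (ℓ * u + -(ℓ * ℓ) / 4 + 10 * (15 : ℕ) * u) := by rw [Real.exp_add, Real.exp_add]
        _ ≤ rexp (-ℓ) := Real.exp_le_exp.mpr hX1
    calc 2 * (216 * B * (rexp (ℓ * u) * rexp (1 / (4 * ℓ ^ 30))) *
          (rexp (-(ℓ * ℓ) / 4) * (Real.sqrt (4 * π * ℓ ^ 30) / 2)))
        = 216 * B * rexp (1 / (4 * ℓ ^ 30)) * Real.sqrt (4 * π * ℓ ^ 30) *
            (rexp (ℓ * u) * rexp (-(ℓ * ℓ) / 4)) := by ring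
      _ ≤ 216 * B * rexp 1 * (4 * ℓ ^ 15) * (rexp (ℓ * u) * rexp (-(ℓ * ℓ) / 4)) := by gcongr
      _ = 864 * rexp 1 * B * (rexp (ℓ * u) * rexp (-(ℓ * ℓ) / 4) * ℓ ^ 15) := by ring
      _ ≤ 864 * rexp 1 * B * rexp (-ℓ) := by gcongr
  have h2 : (20 + (5 + ℓ ^ 16) ^ 3) ^ 3 * (5 + ℓ ^ 16) ^ 3 * Z ^ 3 * d ^ 3 * B *
        (T ^ (-1 / 20 : ℝ) * rexp ((-1 / 20 : ℝ) ^ 2 / (4 * ℓ ^ 30)) / |(-1 / 20 : ℝ)|) *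
      Real.sqrt (4 * π * ℓ ^ 30) ≤ 466560 * rexp 1 * Z ^ 3 * B * rexp (-ℓ) := by
    rw [habs, hTpow]
    have hcore : ℓ ^ 207 * rexp (3 * ℓ) * rexp (-(ℓ * u) / 20) ≤ rexp (-ℓ) := by
      calc ℓ ^ 207 * rexp (3 * ℓ) * rexp (-(ℓ * u) / 20)
          ≤ rexp (10 * (207 : ℕ) * u) * rexp (3 * ℓ) * rexp (-(ℓ * u) / 20) := by gcongr
        _ = rexp (10 * (207 : ℕ) * u + 3 * ℓ + -(ℓ * u) / 20) := by rw [Real.exp_add, Real.exp_add]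
        _ ≤ rexp (-ℓ) := Real.exp_le_exp.mpr hX2
    calc (20 + (5 + ℓ ^ 16) ^ 3) ^ 3 * (5 + ℓ ^ 16) ^ 3 * Z ^ 3 * d ^ 3 * B *
          (rexp (-(ℓ * u) / 20) * rexp ((-1 / 20 : ℝ) ^ 2 / (4 * ℓ ^ 30)) / (1 / 20)) *
          Real.sqrt (4 * π * ℓ ^ 30)
        = 20 * ((20 + (5 + ℓ ^ 16) ^ 3) ^ 3 * (5 + ℓ ^ 16) ^ 3) * d ^ 3 *
            rexp ((-1 / 20 : ℝ) ^ 2 / (4 * ℓ ^ 30)) * Real.sqrt (4 * π * ℓ ^ 30) *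
            (Z ^ 3 * B * rexp (-(ℓ * u) / 20)) := by ring
      _ ≤ 20 * (5832 * ℓ ^ 192) * rexp (3 * ℓ) * rexp 1 * (4 * ℓ ^ 15) *
            (Z ^ 3 * B * rexp (-(ℓ * u) / 20)) := by gcongr
      _ = 466560 * rexp 1 * Z ^ 3 * B * (ℓ ^ 192 * ℓ ^ 15 * rexp (3 * ℓ) * rexp (-(ℓ * u) / 20)) := by
          ring
      _ = 466560 * rexp 1 * Z ^ 3 * B * (ℓ ^ 207 * rexp (3 * ℓ) * rexp (-(ℓ * u) / 20)) := by
          rw [← pow_add]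
      _ ≤ 466560 * rexp 1 * Z ^ 3 * B * rexp (-ℓ) := by gcongr
  have h3 : 2 * ((1 - (-1 / 20 : ℝ)) * ((20 + (5 + ℓ ^ 16) ^ 3) ^ 3 * (5 + ℓ ^ 16) ^ 3 * Z ^ 3 *
        d ^ 3 * B * (max (T ^ (-1 / 20 : ℝ)) T * rexp (max ((-1 / 20 : ℝ) ^ 2) 1 / (4 * ℓ ^ 30)) *
          gauss (4 * ℓ ^ 30)⁻¹ (ℓ ^ 16) / ℓ ^ 16))) ≤ 12248 * rexp 1 * Z ^ 3 * B * rexp (-ℓ) := by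
    rw [hmax, hmax2, hG, hT]
    have hℓ16 : 1 ≤ ℓ ^ 16 := one_le_pow₀ hℓ1
    have hcore : ℓ ^ 192 * rexp (3 * ℓ) * (rexp (ℓ * u) * rexp (-(ℓ * ℓ) / 4)) ≤ rexp (-ℓ) := by
      calc ℓ ^ 192 * rexp (3 * ℓ) * (rexp (ℓ * u) * rexp (-(ℓ * ℓ) / 4))
          ≤ rexp (10 * (192 : ℕ) * u) * rexp (3 * ℓ) * (rexp (ℓ * u) * rexp (-(ℓ * ℓ) / 4)) := by gcongr
        _ = rexp (10 * (192 : ℕ) * u + 3 * ℓ + (ℓ * u + -(ℓ * ℓ) / 4)) := by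
            rw [Real.exp_add, Real.exp_add, Real.exp_add]
        _ ≤ rexp (-ℓ) := Real.exp_le_exp.mpr hX3
    have hdiv : rexp (ℓ * u) * rexp (1 / (4 * ℓ ^ 30)) * rexp (-(ℓ * ℓ) / 4) / ℓ ^ 16 ≤
        rexp (ℓ * u) * rexp 1 * rexp (-(ℓ * ℓ) / 4) := by
      rw [div_le_iff₀ (by positivity)]
      calc rexp (ℓ * u) * rexp (1 / (4 * ℓ ^ 30)) * rexp (-(ℓ * ℓ) / 4)
          ≤ rexp (ℓ * u) * rexp 1 * rexp (-(ℓ * ℓ) / 4) := by gcongr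
        _ = rexp (ℓ * u) * rexp 1 * rexp (-(ℓ * ℓ) / 4) * 1 := (mul_one _).symm
        _ ≤ rexp (ℓ * u) * rexp 1 * rexp (-(ℓ * ℓ) / 4) * ℓ ^ 16 := by gcongr
    calc 2 * ((1 - (-1 / 20 : ℝ)) * ((20 + (5 + ℓ ^ 16) ^ 3) ^ 3 * (5 + ℓ ^ 16) ^ 3 * Z ^ 3 *
          d ^ 3 * B * (rexp (ℓ * u) * rexp (1 / (4 * ℓ ^ 30)) * rexp (-(ℓ * ℓ) / 4) / ℓ ^ 16)))
        = 21 / 10 * ((20 + (5 + ℓ ^ 16) ^ 3) ^ 3 * (5 + ℓ ^ 16) ^ 3) * d ^ 3 *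
            (rexp (ℓ * u) * rexp (1 / (4 * ℓ ^ 30)) * rexp (-(ℓ * ℓ) / 4) / ℓ ^ 16) * (Z ^ 3 * B) := by
          ring
      _ ≤ 21 / 10 * (5832 * ℓ ^ 192) * rexp (3 * ℓ) *
            (rexp (ℓ * u) * rexp 1 * rexp (-(ℓ * ℓ) / 4)) * (Z ^ 3 * B) := by gcongr
      _ = 21 / 10 * 5832 * rexp 1 * Z ^ 3 * B *
            (ℓ ^ 192 * rexp (3 * ℓ) * (rexp (ℓ * u) * rexp (-(ℓ * ℓ) / 4))) := by ring
      _ ≤ 21 / 10 * 5832 * rexp 1 * Z ^ 3 * B * rexp (-ℓ) := by gcongr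
      _ ≤ 12248 * rexp 1 * Z ^ 3 * B * rexp (-ℓ) := by
          have : 0 ≤ rexp 1 * Z ^ 3 * B * rexp (-ℓ) := by positivity
          linarith
  -- sum
  have hπ0 : 0 < 1 / (2 * π) := by positivity
  refine le_trans (mul_le_mul_of_nonneg_left (add_le_add (add_le_add h1 h2) h3) hπ0.le) ?_
  have hnn : 0 ≤ 1 / (2 * π) * rexp 1 * Z ^ 3 * B * rexp (-ℓ) := by positivity
  have hring : 1 / (2 * π) * (864 * rexp 1 * B * rexp (-ℓ) + 466560 * rexp 1 * Z ^ 3 * B * rexp (-ℓ) +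
      12248 * rexp 1 * Z ^ 3 * B * rexp (-ℓ)) =
      1 / (2 * π) * rexp 1 * (864 + 500000 * Z ^ 3) * B * rexp (-ℓ) -
        21192 * (1 / (2 * π) * rexp 1 * Z ^ 3 * B * rexp (-ℓ)) := by ring
  rw [hring]
  linarith

end Scales

/-! ## §5. The cut (C2) of record: the contour shift for `integrand16_u040R` under `Lemma162Rq` -/

section Final

/-- `⌈e^L⌉ ≤ D` gives `𝓛 ≥ L`. [folklore] -/
private theorem le_ell_of_ceil_exp_le₅ {L : ℝ} {D : ℕ} (hD : ⌈Real.exp L⌉₊ ≤ D) : L ≤ ell D := by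
  have h1 : Real.exp L ≤ D := le_trans (Nat.le_ceil _) (by exact_mod_cast hD)
  have hD0 : (0 : ℝ) < D := lt_of_lt_of_le (Real.exp_pos L) h1
  rw [ell, Real.le_log_iff_exp_le hD0]
  exact h1

/-- The last absorption: `K·C·e^{2ℓ^{1/10}}·e^{−ℓ} ≤ ℓ⁻⁵` once `ℓ ≥ 10²⁰` and `ℓ ≥ 2K|C|`. [folklore] -/
private theorem final_absorb {K C ℓ : ℝ} (hK : 0 ≤ K) (hℓ : (10 : ℝ) ^ 20 ≤ ℓ) (hℓK : 2 * (K * |C|) ≤ ℓ) :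
    K * (C * rexp (2 * ℓ ^ (1 / 10 : ℝ))) * rexp (-ℓ) ≤ (ℓ ^ 5)⁻¹ := by
  have hℓ0 : 0 < ℓ := lt_of_lt_of_le (by positivity) hℓ
  obtain ⟨hu, hℓu, -, -⟩ := scales_aux hℓ
  have hp5 := pow_le_exp_aux hℓ 5
  set u : ℝ := ℓ ^ (1 / 10 : ℝ) with hudef
  rcases le_or_gt C 0 with hC | hC
  · have : K * (C * rexp (2 * u)) * rexp (-ℓ) ≤ 0 :=
      mul_nonpos_of_nonpos_of_nonneg (mul_nonpos_of_nonneg_of_nonpos hK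
        (mul_nonpos_of_nonpos_of_nonneg hC (Real.exp_pos _).le)) (Real.exp_pos _).le
    exact this.trans (by positivity)
  rw [abs_of_pos hC] at hℓK
  rw [inv_eq_one_div, le_div_iff₀ (by positivity)]
  have h52 : (52 : ℝ) * u ≤ ℓ / 2 := by nlinarith
  calc K * (C * rexp (2 * u)) * rexp (-ℓ) * ℓ ^ 5
      ≤ K * (C * rexp (2 * u)) * rexp (-ℓ) * rexp (10 * (5 : ℕ) * u) := by gcongr
    _ = K * C * rexp (2 * u + -ℓ + 10 * (5 : ℕ) * u) := by rw [Real.exp_add, Real.exp_add]; ring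
    _ ≤ K * C * rexp (-(ℓ / 2)) := by gcongr; push_cast; linarith
    _ ≤ K * C * (1 / (1 + ℓ / 2)) := by
        gcongr
        rw [Real.exp_neg, ← one_div]
        exact one_div_le_one_div_of_le (by positivity) (by linarith [Real.add_one_le_exp (ℓ / 2)])
    _ ≤ 1 := by
        rw [← mul_div_assoc, mul_one, div_le_one (by positivity)]
        linarith

/-- **Cut (C2) of Block C — the contour shift of u041 for the repaired integrand.** Under
`Lemma162Rq c′`, for all large `D` under (A) and `j = 1, 2`:
`‖(1/2π)∫_ℝ integrand16_u040R(1+iv) dv − (Res₀ + Res_{β_j})‖ ≤ 𝓛⁻⁵`, where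
`Res₀ = (swap dslope 0)^[2] φ₀ 0` (`= ½φ₀″(0)`, `U055.residue_triple_eq`) with
`φ₀(z) = ζ₁(1+z)²·(ζ(1+z−β_j)L(1+z,χ)L(1+z−β_j,χ)²E₂ⱼ(1+z))·T^zω₁(z)` and
`Res_{β_j} = φ_β(β_j)`, `φ_β(z) = ζ(1+z)²ζ₁(1+z−β_j)L(1+z,χ)L(1+z−β_j,χ)²E₂ⱼ(1+z)·(T^zω₁(z)/z)`
(`E₂ⱼ = frakU2R c′ χ j`, the seam texts of zl-libC-p1's CARVE 2026-08-27T01:33:19Z). Route: the engine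
instance `u041_contour_shift_raw` with `U := frakU2R c′ χ j` (holomorphy and clause (iv) transported by
`frakU2R_explicit_bound_of_lemma162Rp ∘ lemma162Rp_of_Rq`; `β_j ≠ 0` by `U041.betaJ_norm_ge`,
`|β_j| < 5α ≤ 1/40`), then `u041_remainder_le` and the final absorption
`K·C·e^{2𝓛^{1/10}}·e^{−𝓛} ≤ 𝓛⁻⁵`. [cite: Zhang2022LandauSiegel, §16 p.94 (u041)] -/
theorem u041_contour (c' : ℝ) (hRq : Lemma162Rq c') :
    ForAllLarge fun D _ χ => AssumptionA D χ → ∀ j ∈ ({1, 2} : Finset ℕ),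
      ‖(1 / (2 * π) : ℂ) * (∫ v : ℝ, integrand16_u040R c' χ j (1 + v * I)) -
          ((Function.swap dslope (0 : ℂ))^[2]
              (fun z : ℂ => riemannZeta₁ (1 + z) ^ 2 *
                (riemannZeta (1 + z - betaJ c' D j) * χ.LFunction (1 + z) *
                  χ.LFunction (1 + z - betaJ c' D j) ^ 2 * frakU2R c' χ j (1 + z)) *
                ((bigT D : ℂ) ^ z * omega1 (ell D ^ 30) z)) 0 +
            (fun z : ℂ => riemannZeta (1 + z) ^ 2 * riemannZeta₁ (1 + z - betaJ c' D j) *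
                χ.LFunction (1 + z) * χ.LFunction (1 + z - betaJ c' D j) ^ 2 *
                frakU2R c' χ j (1 + z) *
                ((bigT D : ℂ) ^ z * omega1 (ell D ^ 30) z / z)) (betaJ c' D j))‖ ≤
        (ell D ^ 5)⁻¹ := by
  obtain ⟨C₁, D₁, hE⟩ := frakU2R_explicit_bound_of_lemma162Rp c' (lemma162Rp_of_Rq c' hRq)
  obtain ⟨K, hK0, hK⟩ := u041_remainder_le
  set L₀ : ℝ := max ((10 : ℝ) ^ 20) (max (Real.pi * (5 * |c'| + 1)) (max (56 * |c'| + 1)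
    (2 * (K * |C₁|)))) with hL₀
  refine ⟨max D₁ ⌈Real.exp L₀⌉₊, fun D _ χ hD hq hp hA j hj => ?_⟩
  have hD₁ : D₁ ≤ D := le_trans (le_max_left _ _) hD
  have hL := le_ell_of_ceil_exp_le₅ (le_trans (le_max_right _ _) hD)
  have hℓ20 : (10 : ℝ) ^ 20 ≤ ell D := le_trans (le_max_left _ _) hL
  have hℓπ : Real.pi * (5 * |c'| + 1) ≤ ell D := le_trans (le_trans (le_max_left _ _) (le_max_right _ _)) hL
  have hℓc : 56 * |c'| + 1 ≤ ell D :=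
    le_trans (le_trans (le_trans (le_max_left _ _) (le_max_right _ _)) (le_max_right _ _)) hL
  have hℓK : 2 * (K * |C₁|) ≤ ell D :=
    le_trans (le_trans (le_trans (le_max_right _ _) (le_max_right _ _)) (le_max_right _ _)) hL
  have hℓ2 : 2 ≤ ell D := le_trans (by norm_num) hℓ20
  have hℓ1 : 1 ≤ ell D := by linarith
  have hℓ0 : 0 < ell D := by linarith
  -- `D ≥ 2`, `χ ≠ χ₀`
  have hD0 : (0 : ℝ) < D := by
    have : (0 : ℝ) < ⌈Real.exp L₀⌉₊ := by
      have := Real.exp_pos L₀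
      exact_mod_cast Nat.lt_ceil.mpr (by simpa using this)
    exact lt_of_lt_of_le this (by exact_mod_cast le_trans (le_max_right _ _) hD)
  have hDexp : (D : ℝ) = rexp (ell D) := by rw [ell, Real.exp_log hD0]
  have hD2 : 2 ≤ D := by
    have h1 : (2 : ℝ) ≤ rexp (ell D) := by
      have := Real.add_one_le_exp (ell D); linarith
    rw [← hDexp] at h1
    exact_mod_cast h1
  have hχ : χ ≠ 1 := CharacterTails.ne_one_of_isPrimitive χ hp hD2
  -- `β_j ≠ 0`, `|β_j| ≤ 1/40`
  have hα : alpha D = Real.pi / ell D ^ 9 := by rw [alpha, bigP, Real.log_exp]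
  have hαpos : 0 < alpha D := by rw [hα]; positivity
  have hπ4 : Real.pi ≤ 4 := Real.pi_le_four
  have hℓ9 : ell D ≤ ell D ^ 9 := le_self_pow₀ hℓ1 (by norm_num)
  have hℓ8 : ell D ≤ ell D ^ 8 := le_self_pow₀ hℓ1 (by norm_num)
  have hα200 : alpha D ≤ 1 / 200 := by
    rw [hα, div_le_iff₀ (by positivity)]
    nlinarith
  have hαℓ : |c' * alpha D * ell D| ≤ 1 / 14 := by
    have hval : alpha D * ell D = Real.pi / ell D ^ 8 := by
      rw [hα]; field_simp
    have h4 : alpha D * ell D ≤ 4 / ell D := by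
      rw [hval]
      calc Real.pi / ell D ^ 8 ≤ 4 / ell D ^ 8 := div_le_div_of_nonneg_right hπ4 (by positivity)
        _ ≤ 4 / ell D := div_le_div_of_nonneg_left (by norm_num) hℓ0 hℓ8
    rw [mul_assoc, abs_mul, abs_of_pos (mul_pos hαpos hℓ0)]
    calc |c'| * (alpha D * ell D) ≤ |c'| * (4 / ell D) := mul_le_mul_of_nonneg_left h4 (abs_nonneg _)
      _ = 4 * |c'| / ell D := by ring
      _ ≤ 1 / 14 := by rw [div_le_iff₀ hℓ0]; linarith
  have hj3 : j ∈ ({1, 2, 3} : Finset ℕ) := by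
    simp only [Finset.mem_insert, Finset.mem_singleton] at hj ⊢
    rcases hj with h | h <;> simp [h]
  have hβge := U041.betaJ_norm_ge c' hαpos hαℓ hj3
  have hβ0 : betaJ c' D j ≠ 0 := by
    intro h; rw [h, norm_zero] at hβge; linarith
  have hβ40 : ‖betaJ c' D j‖ ≤ 1 / 40 := by
    have := norm_betaJ_lt_five_alpha hℓ2 hℓπ hj
    linarith
  -- the continuation `E₂ⱼ` and its bound
  obtain ⟨hEdiff, -, hEB⟩ := hE D χ hD₁ hq hp hA j hj
  set B : ℝ := C₁ * Real.exp (2 * ell D ^ (1 / 10 : ℝ)) with hBdef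
  have hB0 : 0 ≤ B := (norm_nonneg _).trans (hEB 1 (by norm_num))
  -- the raw shift and the remainder
  have hraw := u041_contour_shift_raw c' hχ hℓ2 j hβ0 hβ40 (U := frakU2R c' χ j) (B := B) hEdiff hEB
  have hrem := hK (ell D) B (D : ℝ) hℓ20 hB0 (Nat.cast_nonneg D) (le_of_eq hDexp)
  have hfin : K * B * rexp (-ell D) ≤ (ell D ^ 5)⁻¹ := final_absorb hK0 hℓ20 hℓK
  have hfun : (fun v : ℝ => integrand16_u040R c' χ j (1 + v * I)) =
      fun t : ℝ => normaliserR c' χ j (1 + ((1 : ℂ) + t * I)) * frakU2R c' χ j (1 + ((1 : ℂ) + t * I)) *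
        ((bigT D : ℂ) ^ ((1 : ℂ) + t * I) * omega1 (ell D ^ 30) ((1 : ℂ) + t * I) /
          ((1 : ℂ) + t * I)) := by
    funext t
    simp only [integrand16_u040R]
    ring
  rw [hfun]
  exact hraw.trans (hrem.trans hfin)

end Final

end Literature.NumberTheory.LFunctions.Zhang2022.Typed.Section16B
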